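import Literature.Analysis.FluidPDE.SereginZajaczkowski2007SwirlPressure
import Literature.Analysis.FluidPDE.SereginZajaczkowski2007SwirlCalculus
import HarnessLib

/-!
# Seregin–Zajaczkowski 2007, (4.15): the swirl equation in the sense of distributions

G. Seregin, W. Zajaczkowski, *A sufficient condition of regularity for axially symmetric
solutions to the Navier–Stokes equations*, SIAM J. Math. Anal. 39 (2007) 669–685 =
arXiv:math/0702720, §4, proof of Lemma 4.3: "We know that `V_φ` satisfies the equation (4.15)",
equivalently (multiply by `ϱ`, `α = ϱV_φ = x₀V₁ - x₁V₀`):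
`∂_t α + V·∇α - Δα + (2/ϱ) ∂_ϱ α = 0` off the axis.

Support file (everything proved; no definitions, no named facts) for the discharge of the named
fact `SereginZajaczkowski2007.SwirlEquation`. For the hypothesis class of Prop. 4.1 on
`Q̃ = 𝒞(1/4, 3; 2) × ]-2², 0[` (`IsSmoothAxisymmetricSolutionOn`: distributional Navier–Stokes,
axial symmetry and `x`-smoothness at the points of `Q̃`, all spatial derivatives continuous in
space–time; NO time regularity) this file proves the swirl equation in the sense of
distributions on `Q̃`, with the classical right-hand side:

> `∫∫ (α ∂ₜφ + (Δα - Dα[V] - (2/ϱ)∂_ϱα) φ) dx dt = 0` for every `φ ∈ C_c^∞(Q̃)`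
> (`integral_swirl_mul_timeDeriv_add_eq_zero`).

Proof. Test the momentum equation with `ψ = φ J` (`J x = (-x₁, x₀, 0)`): pointwise
`⟪V, ∂ₜψ⟫ = α∂ₜφ`, `⟪V, (V·∇)ψ⟫ = α Dφ[V]`, `⟪V, Δψ⟫ = αΔφ - 2⟪JV, ∇φ⟫`, `P div ψ = P⟪J, ∇φ⟫`
(`SereginZajaczkowski2007SwirlRotation`); the pressure term integrates to zero
(`SereginZajaczkowski2007SwirlPressure`, rotation averaging); the remaining `x`-derivatives are
moved from `φ` onto the smooth-in-`x` field slice by slice (`integral_mul_fderiv_slice_eq_neg`,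
`SereginZajaczkowski2007SwirlCalculus`): `Σⱼ ∂ⱼ(αVⱼ) = Dα[V]` (`div V = 0` pointwise for the
class), `Σⱼ ∂ⱼ∂ⱼα = ⟪Jx, ΔV⟫ + 2(∂₀V₁ - ∂₁V₀)`, `Σⱼ ∂ⱼ(JV)ⱼ = -(∂₀V₁ - ∂₁V₀)`, and
`ΔΓ = ⟪Jx, ΔV⟫ + 2(∂₀V₁ - ∂₁V₀)`, `∂ᵣΓ = ϱ(∂₀V₁ - ∂₁V₀)` (axial symmetry) identify the result
with `Δα - Dα[V] - (2/ϱ)∂_ϱα`.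

## References

* G. Seregin, W. Zajaczkowski, SIAM J. Math. Anal. 39 (2007) 669–685, arXiv:math/0702720, §4
  proof of Lemma 4.3, (4.15) and "`α = V_φ ϱ`". [`SereginZajaczkowski2007`]
* G. Koch, N. Nadirashvili, G. Seregin, V. Šverák, Acta Math. 203 (2009) 83–105, (1.8)
  (the equation for `Γ = r u_θ`). [`KochNadirashviliSereginSverak2009`]
-/

noncomputable section

open MeasureTheory Set Function Filter Topology TopologicalSpace Metric WithLp
open scoped NNReal ENNReal ContDiff InnerProductSpace RealInnerProductSpace Laplacian

namespace Literature.Analysis.FluidPDE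

namespace SereginZajaczkowski2007

open SereginSverak2009

/-! ### Expansions in the standard frame -/

section Frame

/-- Expansion of a linear form in the standard frame: `L w = Σⱼ ⟪w, eⱼ⟫ L eⱼ`. [folklore] -/
theorem clm_apply_eq_sum_inner_mul (L : (EuclideanSpace ℝ (Fin 3)) →L[ℝ] ℝ) (w : (EuclideanSpace ℝ (Fin 3))) :
    L w = ∑ j, ⟪w, EuclideanSpace.basisFun (Fin 3) ℝ j⟫ * L (EuclideanSpace.basisFun (Fin 3) ℝ j) := by
  conv_lhs => rw [← (EuclideanSpace.basisFun (Fin 3) ℝ).sum_repr' w]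
  rw [map_sum]
  refine Finset.sum_congr rfl fun j _ => ?_
  rw [map_smul, smul_eq_mul, real_inner_comm w]

/-- `⟪w, ∇f⟫ = Σⱼ ⟪w, eⱼ⟫ ∂ⱼf`. [folklore] -/
theorem inner_gradient_eq_sum_inner_mul (f : (EuclideanSpace ℝ (Fin 3)) → ℝ) (x w : (EuclideanSpace ℝ (Fin 3))) :
    ⟪w, gradient f x⟫ = ∑ j, ⟪w, EuclideanSpace.basisFun (Fin 3) ℝ j⟫ *
      fderiv ℝ f x (EuclideanSpace.basisFun (Fin 3) ℝ j) := by
  rw [real_inner_comm, inner_gradient_left, clm_apply_eq_sum_inner_mul]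

/-- `⟪J v, e⟫ = -⟪J e, v⟫`. [folklore] -/
theorem inner_rotGen_comm_neg (v e : (EuclideanSpace ℝ (Fin 3))) : ⟪rotGen v, e⟫ = -⟪rotGen e, v⟫ := by
  rw [inner_rotGen_left, inner_rotGen_left]
  ring

end Frame

/-! ### The weak form tested with `φ J`, pointwise -/

section Pointwise

variable {Q : Opens (ℝ × (EuclideanSpace ℝ (Fin 3)))} {V : ℝ → (EuclideanSpace ℝ (Fin 3)) → (EuclideanSpace ℝ (Fin 3))} {P : ℝ → (EuclideanSpace ℝ (Fin 3)) → ℝ} {φ : ℝ → (EuclideanSpace ℝ (Fin 3)) → ℝ}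

/-- **The weak Navier–Stokes integrand for `ψ = φ J`, pointwise**: with `α = x₀V₁ - x₁V₀`,
`⟪V, ∂ₜψ⟫ + ⟪V, (V·∇)ψ⟫ + ⟪V, Δψ⟫ + P div ψ = α ∂ₜφ + α Dφ[V] + α Δφ - 2⟪JV, ∇φ⟫ + P ⟪J, ∇φ⟫`
(no force, `ν = 1`). [folklore] -/
theorem nsIntegrand_smul_rotGen (hφ : IsSpaceTimeTestOn Q φ) (z : ℝ × (EuclideanSpace ℝ (Fin 3))) :
    ⟪V z.1 z.2, timeDeriv (fun s y => φ s y • rotGen y) z.1 z.2⟫ +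
        ⟪V z.1 z.2, convect (V z.1) ((fun s y => φ s y • rotGen y) z.1) z.2⟫ +
        1 * ⟪V z.1 z.2, Δ ((fun s y => φ s y • rotGen y) z.1) z.2⟫ +
        P z.1 z.2 * VectorCalculus.divergence ((fun s y => φ s y • rotGen y) z.1) z.2 +
        ⟪(0 : ℝ → (EuclideanSpace ℝ (Fin 3)) → (EuclideanSpace ℝ (Fin 3))) z.1 z.2, (fun s y => φ s y • rotGen y) z.1 z.2⟫ =
      swirl (V z.1) z.2 * timeDeriv φ z.1 z.2 +
        fderiv ℝ (φ z.1) z.2 (V z.1 z.2) * swirl (V z.1) z.2 +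
        ((Δ (φ z.1)) z.2 * swirl (V z.1) z.2 - 2 * ⟪rotGen (V z.1 z.2), gradient (φ z.1) z.2⟫) +
        P z.1 z.2 * ⟪rotGen z.2, gradient (φ z.1) z.2⟫ := by
  have hφd : DifferentiableAt ℝ (φ z.1) z.2 :=
    ((hφ.contDiff_slice z.1).differentiable (by simp)).differentiableAt
  have hφ2 : ContDiff ℝ 2 (φ z.1) := (hφ.contDiff_slice z.1).of_le (by norm_cast)
  rw [timeDeriv_smul_rotGen hφ, inner_smul_right, inner_rotGen_eq_swirl',
    inner_convect_smul_rotGen hφd, inner_laplacian_smul_rotGen hφ2, divergence_smul_rotGen hφd]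
  simp only [Pi.zero_apply, inner_zero_left, add_zero, one_mul]
  ring

/-- The same integrand with the `x`-derivatives of `φ` expanded in the standard frame:
`α Dφ[V] = Σⱼ (αVⱼ) ∂ⱼφ`, `⟪JV, ∇φ⟫ = Σⱼ (JV)ⱼ ∂ⱼφ`, `Δφ = Σⱼ ∂ⱼ∂ⱼφ`. [folklore] -/
theorem nsIntegrand_smul_rotGen_eq_sum (hφ : IsSpaceTimeTestOn Q φ) (z : ℝ × (EuclideanSpace ℝ (Fin 3))) :
    ⟪V z.1 z.2, timeDeriv (fun s y => φ s y • rotGen y) z.1 z.2⟫ +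
        ⟪V z.1 z.2, convect (V z.1) ((fun s y => φ s y • rotGen y) z.1) z.2⟫ +
        1 * ⟪V z.1 z.2, Δ ((fun s y => φ s y • rotGen y) z.1) z.2⟫ +
        P z.1 z.2 * VectorCalculus.divergence ((fun s y => φ s y • rotGen y) z.1) z.2 +
        ⟪(0 : ℝ → (EuclideanSpace ℝ (Fin 3)) → (EuclideanSpace ℝ (Fin 3))) z.1 z.2, (fun s y => φ s y • rotGen y) z.1 z.2⟫ =
      (swirl (V z.1) z.2 * timeDeriv φ z.1 z.2 +
        ∑ j, ((swirl (V z.1) z.2 * ⟪V z.1 z.2, EuclideanSpace.basisFun (Fin 3) ℝ j⟫) *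
              fderiv ℝ (φ z.1) z.2 (EuclideanSpace.basisFun (Fin 3) ℝ j) -
            2 * (⟪rotGen (V z.1 z.2), EuclideanSpace.basisFun (Fin 3) ℝ j⟫ *
              fderiv ℝ (φ z.1) z.2 (EuclideanSpace.basisFun (Fin 3) ℝ j)) +
            swirl (V z.1) z.2 * fderiv ℝ (fun y => fderiv ℝ (φ z.1) y
              (EuclideanSpace.basisFun (Fin 3) ℝ j)) z.2 (EuclideanSpace.basisFun (Fin 3) ℝ j))) +
        P z.1 z.2 * ⟪rotGen z.2, gradient (φ z.1) z.2⟫ := by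
  have hφ2 : ContDiff ℝ 2 (φ z.1) := (hφ.contDiff_slice z.1).of_le (by norm_cast)
  rw [nsIntegrand_smul_rotGen hφ z, clm_apply_eq_sum_inner_mul (fderiv ℝ (φ z.1) z.2) (V z.1 z.2),
    inner_gradient_eq_sum_inner_mul (φ z.1) z.2 (rotGen (V z.1 z.2)),
    laplacian_eq_sum_fderiv_fderiv (EuclideanSpace.basisFun (Fin 3) ℝ) hφ2 z.2]
  simp only [Finset.sum_mul, Finset.mul_sum, Finset.sum_add_distrib, Finset.sum_sub_distrib]
  ring

end Pointwise

/-! ### Integrability against test factors -/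

section Integrability

variable {U : Opens (ℝ × (EuclideanSpace ℝ (Fin 3)))}

/-- `g θ` is integrable for `g` continuous on `U` and `θ` a space–time test function on `U`.
[folklore] -/
theorem integrable_mul_test {g : ℝ × (EuclideanSpace ℝ (Fin 3)) → ℝ} {θ : ℝ → (EuclideanSpace ℝ (Fin 3)) → ℝ} (hg : ContinuousOn g (U : Set (ℝ × (EuclideanSpace ℝ (Fin 3)))))
    (hθ : IsSpaceTimeTestOn U θ) : Integrable (fun z : ℝ × (EuclideanSpace ℝ (Fin 3)) => g z * θ z.1 z.2) := by
  have h := integrable_mul_of_tsupport_subset hθ.contDiff.continuous hθ.hasCompactSupport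
    hθ.tsupport_subset hg
  exact h.congr (Eventually.of_forall fun z => mul_comm _ _)

/-- `θ g` is integrable for `g` continuous on `U` and `θ` a space–time test function on `U`.
[folklore] -/
theorem integrable_test_mul {g : ℝ × (EuclideanSpace ℝ (Fin 3)) → ℝ} {θ : ℝ → (EuclideanSpace ℝ (Fin 3)) → ℝ} (hg : ContinuousOn g (U : Set (ℝ × (EuclideanSpace ℝ (Fin 3)))))
    (hθ : IsSpaceTimeTestOn U θ) : Integrable (fun z : ℝ × (EuclideanSpace ℝ (Fin 3)) => θ z.1 z.2 * g z) :=
  integrable_mul_of_tsupport_subset hθ.contDiff.continuous hθ.hasCompactSupport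
    hθ.tsupport_subset hg

/-- The time derivative of a test function times a factor continuous on `U` is integrable.
[folklore] -/
theorem integrable_mul_timeDeriv {g : ℝ × (EuclideanSpace ℝ (Fin 3)) → ℝ} {θ : ℝ → (EuclideanSpace ℝ (Fin 3)) → ℝ}
    (hg : ContinuousOn g (U : Set (ℝ × (EuclideanSpace ℝ (Fin 3))))) (hθ : IsSpaceTimeTestOn U θ) :
    Integrable (fun z : ℝ × (EuclideanSpace ℝ (Fin 3)) => g z * timeDeriv θ z.1 z.2) := by
  have hK : IsCompact (tsupport (uncurry θ)) := hθ.hasCompactSupport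
  have hc : Continuous fun z : ℝ × (EuclideanSpace ℝ (Fin 3)) => timeDeriv θ z.1 z.2 := hθ.continuous_timeDeriv
  have hs : HasCompactSupport fun z : ℝ × (EuclideanSpace ℝ (Fin 3)) => timeDeriv θ z.1 z.2 :=
    HasCompactSupport.intro hK fun z hz => timeDeriv_eq_zero_off_tsupport hz
  have hsub : tsupport (fun z : ℝ × (EuclideanSpace ℝ (Fin 3)) => timeDeriv θ z.1 z.2) ⊆ (U : Set (ℝ × (EuclideanSpace ℝ (Fin 3)))) := by
    refine (closure_minimal (fun z hz => ?_) (isClosed_tsupport _)).trans hθ.tsupport_subset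
    by_contra h
    exact hz (timeDeriv_eq_zero_off_tsupport h)
  have h := integrable_mul_of_tsupport_subset hc hs hsub hg
  exact h.congr (Eventually.of_forall fun z => mul_comm _ _)

end Integrability

/-! ### Moving the derivatives onto the velocity -/

section Transfer

variable {V : ℝ → (EuclideanSpace ℝ (Fin 3)) → (EuclideanSpace ℝ (Fin 3))} {P : ℝ → (EuclideanSpace ℝ (Fin 3)) → ℝ} {S : Opens (ℝ × (EuclideanSpace ℝ (Fin 3)))} {φ : ℝ → (EuclideanSpace ℝ (Fin 3)) → ℝ}

/-- `∂ₑ(α⟪V, e⟫) = α⟪∂ₑV, e⟫ + ⟪V, e⟫ ∂ₑα` at the points of `S`. [folklore] -/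
theorem fderiv_swirl_mul_inner_apply (hV : IsSmoothAxisymmetricSolutionOn S V P) {z : ℝ × (EuclideanSpace ℝ (Fin 3))}
    (hz : z ∈ (S : Set (ℝ × (EuclideanSpace ℝ (Fin 3))))) (e : (EuclideanSpace ℝ (Fin 3))) :
    fderiv ℝ (fun y => swirl (V z.1) y * ⟪V z.1 y, e⟫) z.2 e =
      swirl (V z.1) z.2 * ⟪fderiv ℝ (V z.1) z.2 e, e⟫ + ⟪V z.1 z.2, e⟫ * fderiv ℝ (swirl (V z.1)) z.2 e := by
  rw [fderiv_fun_mul (differentiableAt_swirl (hV.differentiableAt hz))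
    ((hV.differentiableAt hz).inner ℝ (differentiableAt_const e))]
  simp only [_root_.add_apply, _root_.FunLike.coe_smul, Pi.smul_apply, smul_eq_mul,
    hV.fderiv_inner_const_apply hz e e]

/-- `∂ₑ(α⟪V, e⟫)` is continuous on `S` in space–time. [folklore] -/
theorem continuousOn_fderiv_swirl_mul_inner (hV : IsSmoothAxisymmetricSolutionOn S V P) (e : (EuclideanSpace ℝ (Fin 3))) :
    ContinuousOn (fun z : ℝ × (EuclideanSpace ℝ (Fin 3)) => fderiv ℝ (fun y => swirl (V z.1) y * ⟪V z.1 y, e⟫) z.2 e)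
      (S : Set (ℝ × (EuclideanSpace ℝ (Fin 3)))) := by
  have hc : ContinuousOn (fun z : ℝ × (EuclideanSpace ℝ (Fin 3)) => swirl (V z.1) z.2 * ⟪fderiv ℝ (V z.1) z.2 e, e⟫ +
      ⟪V z.1 z.2, e⟫ * fderiv ℝ (swirl (V z.1)) z.2 e) (S : Set (ℝ × (EuclideanSpace ℝ (Fin 3)))) :=
    (hV.continuousOn_swirl.mul (hV.continuousOn_inner_fderiv_const e e)).add
      ((hV.continuousOn_inner_const e).mul (hV.continuousOn_fderiv_swirl_apply e))
  exact hc.congr fun z hz => fderiv_swirl_mul_inner_apply hV hz e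

/-- `⟪J ∂ₑV, e⟫` is continuous on `S` in space–time. [folklore] -/
theorem continuousOn_inner_rotGen_fderiv (hV : IsSmoothAxisymmetricSolutionOn S V P) (e : (EuclideanSpace ℝ (Fin 3))) :
    ContinuousOn (fun z : ℝ × (EuclideanSpace ℝ (Fin 3)) => ⟪rotGen (fderiv ℝ (V z.1) z.2 e), e⟫) (S : Set (ℝ × (EuclideanSpace ℝ (Fin 3)))) :=
  (rotGenL.continuous.comp_continuousOn (hV.continuousOn_fderiv.clm_apply continuousOn_const)).inner
    continuousOn_const

/-- `∫∫ (α⟪V, e⟫) ∂ₑφ = -∫∫ ∂ₑ(α⟪V, e⟫) φ` for the class. [folklore] -/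
theorem integral_swirl_mul_inner_mul_fderiv (hV : IsSmoothAxisymmetricSolutionOn S V P)
    (hφ : IsSpaceTimeTestOn S φ) (e : (EuclideanSpace ℝ (Fin 3))) :
    ∫ z : ℝ × (EuclideanSpace ℝ (Fin 3)), (swirl (V z.1) z.2 * ⟪V z.1 z.2, e⟫) * fderiv ℝ (φ z.1) z.2 e =
      -∫ z : ℝ × (EuclideanSpace ℝ (Fin 3)), fderiv ℝ (fun y => swirl (V z.1) y * ⟪V z.1 y, e⟫) z.2 e * φ z.1 z.2 := by
  have h := integral_mul_fderiv_slice_eq_neg (U := S)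
    (g := fun z => swirl (V z.1) z.2 * ⟪V z.1 z.2, e⟫) (v := e)
    (hV.continuousOn_swirl.mul (hV.continuousOn_inner_const e))
    (fun z hz => (differentiableAt_swirl (hV.differentiableAt hz)).mul
      ((hV.differentiableAt hz).inner ℝ (differentiableAt_const e)))
    (continuousOn_fderiv_swirl_mul_inner hV e) hφ
  simpa only using h

/-- `∫∫ ⟪JV, e⟫ ∂ₑφ = -∫∫ ⟪J ∂ₑV, e⟫ φ` for the class. [folklore] -/
theorem integral_inner_rotGen_mul_fderiv (hV : IsSmoothAxisymmetricSolutionOn S V P)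
    (hφ : IsSpaceTimeTestOn S φ) (e : (EuclideanSpace ℝ (Fin 3))) :
    ∫ z : ℝ × (EuclideanSpace ℝ (Fin 3)), ⟪rotGen (V z.1 z.2), e⟫ * fderiv ℝ (φ z.1) z.2 e =
      -∫ z : ℝ × (EuclideanSpace ℝ (Fin 3)), ⟪rotGen (fderiv ℝ (V z.1) z.2 e), e⟫ * φ z.1 z.2 := by
  have hd : ContinuousOn (fun z : ℝ × (EuclideanSpace ℝ (Fin 3)) => fderiv ℝ (fun y => ⟪rotGen (V z.1 y), e⟫) z.2 e)
      (S : Set (ℝ × (EuclideanSpace ℝ (Fin 3)))) :=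
    (continuousOn_inner_rotGen_fderiv hV e).congr fun z hz => hV.fderiv_inner_rotGen_const_apply hz e e
  have h := integral_mul_fderiv_slice_eq_neg (U := S) (g := fun z => ⟪rotGen (V z.1 z.2), e⟫) (v := e)
    ((rotGenL.continuous.comp_continuousOn hV.continuousOn_velocity).inner continuousOn_const)
    (fun z hz => hV.differentiableAt_inner_rotGen_const hz e) hd hφ
  simp only at h
  rw [h]
  congr 1
  refine integral_congr_ae (Eventually.of_forall fun z => ?_)
  show fderiv ℝ (fun y => ⟪rotGen (V z.1 y), e⟫) z.2 e * φ z.1 z.2 =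
    ⟪rotGen (fderiv ℝ (V z.1) z.2 e), e⟫ * φ z.1 z.2
  by_cases hz : z ∈ (S : Set (ℝ × (EuclideanSpace ℝ (Fin 3))))
  · rw [hV.fderiv_inner_rotGen_const_apply hz e e]
  · rw [hφ.apply_eq_zero hz, mul_zero, mul_zero]

/-- `∫∫ α ∂ₑ∂ₑφ = ∫∫ (∂ₑ∂ₑα) φ` for the class (twice by parts). [folklore] -/
theorem integral_swirl_mul_fderiv_fderiv (hV : IsSmoothAxisymmetricSolutionOn S V P)
    (hφ : IsSpaceTimeTestOn S φ) (e : (EuclideanSpace ℝ (Fin 3))) :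
    ∫ z : ℝ × (EuclideanSpace ℝ (Fin 3)), swirl (V z.1) z.2 * fderiv ℝ (fun y => fderiv ℝ (φ z.1) y e) z.2 e =
      ∫ z : ℝ × (EuclideanSpace ℝ (Fin 3)), fderiv ℝ (fun y => fderiv ℝ (swirl (V z.1)) y e) z.2 e * φ z.1 z.2 := by
  have hφ' := isSpaceTimeTestOn_fderiv_apply hφ e
  have h1 := integral_mul_fderiv_slice_eq_neg (U := S) (g := fun z => swirl (V z.1) z.2) (v := e)
    hV.continuousOn_swirl (fun z hz => differentiableAt_swirl (hV.differentiableAt hz))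
    (hV.continuousOn_fderiv_swirl_apply e) hφ'
  have h2 := integral_mul_fderiv_slice_eq_neg (U := S)
    (g := fun z => fderiv ℝ (swirl (V z.1)) z.2 e) (v := e)
    (hV.continuousOn_fderiv_swirl_apply e) (fun z hz => hV.differentiableAt_fderiv_swirl_apply e hz)
    (hV.continuousOn_fderiv_fderiv_swirl_apply e) hφ
  simp only at h1 h2 ⊢
  rw [h1, h2, neg_neg]

end Transfer

/-! ### The pointwise identity on `Q̃` -/

section PointwiseQ

variable {V : ℝ → (EuclideanSpace ℝ (Fin 3)) → (EuclideanSpace ℝ (Fin 3))} {P : ℝ → (EuclideanSpace ℝ (Fin 3)) → ℝ} {S : Opens (ℝ × (EuclideanSpace ℝ (Fin 3)))}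

/-- `Σⱼ ∂ⱼ(α⟪V, eⱼ⟫) = Dα[V]` at the points of `S` (`div V = 0`). [folklore] -/
theorem sum_fderiv_swirl_mul_inner (hV : IsSmoothAxisymmetricSolutionOn S V P) {z : ℝ × (EuclideanSpace ℝ (Fin 3))}
    (hz : z ∈ (S : Set (ℝ × (EuclideanSpace ℝ (Fin 3))))) :
    ∑ j, fderiv ℝ (fun y => swirl (V z.1) y * ⟪V z.1 y, (EuclideanSpace.basisFun (Fin 3) ℝ) j⟫) z.2 ((EuclideanSpace.basisFun (Fin 3) ℝ) j) =
      fderiv ℝ (swirl (V z.1)) z.2 (V z.1 z.2) := by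
  simp only [fderiv_swirl_mul_inner_apply hV hz, Finset.sum_add_distrib]
  have hdiv : ∑ j, swirl (V z.1) z.2 * ⟪fderiv ℝ (V z.1) z.2 ((EuclideanSpace.basisFun (Fin 3) ℝ) j), (EuclideanSpace.basisFun (Fin 3) ℝ) j⟫ = 0 := by
    rw [← Finset.mul_sum]
    have h := hV.divergence_eq_zero hz
    rw [divergence_eq_sum_inner_fderiv (EuclideanSpace.basisFun (Fin 3) ℝ)] at h
    have h' : ∑ j, ⟪fderiv ℝ (V z.1) z.2 ((EuclideanSpace.basisFun (Fin 3) ℝ) j), (EuclideanSpace.basisFun (Fin 3) ℝ) j⟫ = 0 := by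
      rw [← h]
      exact Finset.sum_congr rfl fun j _ => real_inner_comm _ _
    rw [h', mul_zero]
  rw [hdiv, zero_add, clm_apply_eq_sum_inner_mul (fderiv ℝ (swirl (V z.1)) z.2) (V z.1 z.2)]

/-- `Σⱼ ⟪Jx, D²u(eⱼ,eⱼ)⟫ = ⟪Jx, Δu⟫`. [folklore] -/
theorem sum_inner_rotGen_iteratedFDeriv (u : (EuclideanSpace ℝ (Fin 3)) → (EuclideanSpace ℝ (Fin 3))) (x : (EuclideanSpace ℝ (Fin 3))) :
    ∑ j, ⟪rotGen x, iteratedFDeriv ℝ 2 u x ![(EuclideanSpace.basisFun (Fin 3) ℝ) j, (EuclideanSpace.basisFun (Fin 3) ℝ) j]⟫ = ⟪rotGen x, (Δ u) x⟫ := by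
  rw [← inner_sum, InnerProductSpace.laplacian_eq_iteratedFDeriv_orthonormalBasis u (EuclideanSpace.basisFun (Fin 3) ℝ)]

/-- **The transferred derivatives give the swirl operator**, at the points of
`Q̃ = 𝒞(1/4,3;2) × ]-4,0[`: with `eⱼ` the standard frame,
`Σⱼ (-∂ⱼ(αVⱼ) + 2⟪J ∂ⱼV, eⱼ⟫ + ∂ⱼ∂ⱼα) = Δα - Dα[V] - (2/ϱ)∂_ϱα`. Uses `div V = 0`, the local
Laplacian of the swirl `Δα = ⟪Jx, ΔV⟫ + 2(∂₀V₁ - ∂₁V₀)`, the radial derivative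
`∂_ϱα = ϱ(∂₀V₁ - ∂₁V₀)` (axial symmetry) and `ϱ > 1/4` on the shell; the vorticity terms cancel
(`⟪J ∂ⱼV, eⱼ⟫ = -⟪J eⱼ, ∂ⱼV⟫`). [folklore] -/
theorem sum_transfer_eq_swirlOperator
    (hV : IsSmoothAxisymmetricSolutionOn (shellCylOpens (1 / 4) 3 2 2) V P) {z : ℝ × (EuclideanSpace ℝ (Fin 3))}
    (hz : z ∈ shellCyl (1 / 4) 3 2 2) :
    ∑ j, (-fderiv ℝ (fun y => swirl (V z.1) y * ⟪V z.1 y, (EuclideanSpace.basisFun (Fin 3) ℝ) j⟫) z.2 ((EuclideanSpace.basisFun (Fin 3) ℝ) j) +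
        2 * ⟪rotGen (fderiv ℝ (V z.1) z.2 ((EuclideanSpace.basisFun (Fin 3) ℝ) j)), (EuclideanSpace.basisFun (Fin 3) ℝ) j⟫ +
        fderiv ℝ (fun y => fderiv ℝ (swirl (V z.1)) y ((EuclideanSpace.basisFun (Fin 3) ℝ) j)) z.2 ((EuclideanSpace.basisFun (Fin 3) ℝ) j)) =
      (Δ (swirl (V z.1))) z.2 - fderiv ℝ (swirl (V z.1)) z.2 (V z.1 z.2) -
        2 / cylRadius z.2 * partialDeriv (eR z.2) (swirl (V z.1)) z.2 := by
  have hz' : z ∈ (shellCylOpens (1 / 4) 3 2 2 : Set (ℝ × (EuclideanSpace ℝ (Fin 3)))) := hz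
  have hsm := hV.contDiffAt z hz'
  have hd := hV.differentiableAt hz'
  have hW3 : ∀ j, fderiv ℝ (fun y => fderiv ℝ (swirl (V z.1)) y ((EuclideanSpace.basisFun (Fin 3) ℝ) j)) z.2 ((EuclideanSpace.basisFun (Fin 3) ℝ) j) =
      ⟪rotGen z.2, iteratedFDeriv ℝ 2 (V z.1) z.2 ![(EuclideanSpace.basisFun (Fin 3) ℝ) j, (EuclideanSpace.basisFun (Fin 3) ℝ) j]⟫ +
        2 * ⟪rotGen ((EuclideanSpace.basisFun (Fin 3) ℝ) j), fderiv ℝ (V z.1) z.2 ((EuclideanSpace.basisFun (Fin 3) ℝ) j)⟫ :=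
    fun j => fderiv_fderiv_swirl_apply_of_contDiffAt hsm ((EuclideanSpace.basisFun (Fin 3) ℝ) j)
  have hW2 : ∀ j, ⟪rotGen (fderiv ℝ (V z.1) z.2 ((EuclideanSpace.basisFun (Fin 3) ℝ) j)), (EuclideanSpace.basisFun (Fin 3) ℝ) j⟫ =
      -⟪rotGen ((EuclideanSpace.basisFun (Fin 3) ℝ) j), fderiv ℝ (V z.1) z.2 ((EuclideanSpace.basisFun (Fin 3) ℝ) j)⟫ := fun j => inner_rotGen_comm_neg _ _
  have hsum : ∑ j, (-fderiv ℝ (fun y => swirl (V z.1) y * ⟪V z.1 y, (EuclideanSpace.basisFun (Fin 3) ℝ) j⟫) z.2 ((EuclideanSpace.basisFun (Fin 3) ℝ) j) +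
        2 * ⟪rotGen (fderiv ℝ (V z.1) z.2 ((EuclideanSpace.basisFun (Fin 3) ℝ) j)), (EuclideanSpace.basisFun (Fin 3) ℝ) j⟫ +
        fderiv ℝ (fun y => fderiv ℝ (swirl (V z.1)) y ((EuclideanSpace.basisFun (Fin 3) ℝ) j)) z.2 ((EuclideanSpace.basisFun (Fin 3) ℝ) j)) =
      ⟪rotGen z.2, (Δ (V z.1)) z.2⟫ - fderiv ℝ (swirl (V z.1)) z.2 (V z.1 z.2) := by
    have hterm : ∀ j, -fderiv ℝ (fun y => swirl (V z.1) y * ⟪V z.1 y, (EuclideanSpace.basisFun (Fin 3) ℝ) j⟫) z.2 ((EuclideanSpace.basisFun (Fin 3) ℝ) j) +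
        2 * ⟪rotGen (fderiv ℝ (V z.1) z.2 ((EuclideanSpace.basisFun (Fin 3) ℝ) j)), (EuclideanSpace.basisFun (Fin 3) ℝ) j⟫ +
        fderiv ℝ (fun y => fderiv ℝ (swirl (V z.1)) y ((EuclideanSpace.basisFun (Fin 3) ℝ) j)) z.2 ((EuclideanSpace.basisFun (Fin 3) ℝ) j) =
        ⟪rotGen z.2, iteratedFDeriv ℝ 2 (V z.1) z.2 ![(EuclideanSpace.basisFun (Fin 3) ℝ) j, (EuclideanSpace.basisFun (Fin 3) ℝ) j]⟫ -
          fderiv ℝ (fun y => swirl (V z.1) y * ⟪V z.1 y, (EuclideanSpace.basisFun (Fin 3) ℝ) j⟫) z.2 ((EuclideanSpace.basisFun (Fin 3) ℝ) j) := by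
      intro j
      rw [hW3, hW2]
      ring
    simp only [hterm, Finset.sum_sub_distrib, sum_inner_rotGen_iteratedFDeriv,
      sum_fderiv_swirl_mul_inner hV hz']
  rw [hsum]
  -- the swirl operator at `z`
  have hax : ∀ θ : ℝ, ∀ y ∈ {y : (EuclideanSpace ℝ (Fin 3)) | (z.1, y) ∈ shellCyl (1 / 4) 3 2 2},
      V z.1 (rotZ θ y) = rotZ θ (V z.1 y) := fun θ y hy => hV.axisymmetric θ (z.1, y) hy
  have hρ : cylRadius z.2 ≠ 0 := cylRadius_ne_zero_of_mem_shell (by norm_num) hz.2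
  have hx : z.2 ∈ {y : (EuclideanSpace ℝ (Fin 3)) | (z.1, y) ∈ shellCyl (1 / 4) 3 2 2} := hz
  rw [laplacian_swirl_of_contDiffAt hsm, partialDeriv_eR_swirl_of_mem hax hx hd]
  field_simp
  ring

end PointwiseQ

/-! ### The weak swirl equation -/

section Weak

variable {V : ℝ → (EuclideanSpace ℝ (Fin 3)) → (EuclideanSpace ℝ (Fin 3))} {P : ℝ → (EuclideanSpace ℝ (Fin 3)) → ℝ} {φ : ℝ → (EuclideanSpace ℝ (Fin 3)) → ℝ}

/-- `Q̃` is invariant under the space–time rotations about the axis. [folklore] -/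
theorem stRot_mem_shellCylOpens (θ : ℝ) (z : ℝ × (EuclideanSpace ℝ (Fin 3)))
    (hz : z ∈ (shellCylOpens (1 / 4) 3 2 2 : Set (ℝ × (EuclideanSpace ℝ (Fin 3))))) :
    stRot θ z ∈ (shellCylOpens (1 / 4) 3 2 2 : Set (ℝ × (EuclideanSpace ℝ (Fin 3)))) :=
  (stRot_mem_shellCyl_iff θ).2 hz

/-- **Seregin–Zajaczkowski 2007, (4.15) in the sense of distributions.** Under the assumptions of
Prop. 4.1 (`IsSmoothAxisymmetricSolutionOn Q̃ V P`, `Q̃ = 𝒞(1/4, 3; 2) × ]-2², 0[`), the swirl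
`α = x₀V₁ - x₁V₀` (`= ϱ V_φ`) satisfies, for every scalar test function `φ ∈ C_c^∞(Q̃)`,
`∫∫ (α ∂ₜφ + (Δα - Dα[V] - (2/ϱ)∂_ϱα) φ) dx dt = 0`, i.e.
`∂ₜα = Δα - V·∇α - (2/ϱ)∂_ϱα` in `𝒟'(Q̃)` — (4.15) multiplied by `ϱ` ("`α = V_φ ϱ`"). Proof in
the module docstring: momentum equation tested with `φ J`, pressure removed by rotation
averaging, `x`-derivatives transferred slice by slice onto the smooth-in-`x` velocity.
[cite: SereginZajaczkowski2007, §4 proof of Lemma 4.3, (4.15)] -/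
theorem integral_swirl_mul_timeDeriv_add_eq_zero
    (hV : IsSmoothAxisymmetricSolutionOn (shellCylOpens (1 / 4) 3 2 2) V P)
    (hφ : IsSpaceTimeTestOn (shellCylOpens (1 / 4) 3 2 2) φ) :
    ∫ z : ℝ × (EuclideanSpace ℝ (Fin 3)), (swirl (V z.1) z.2 * timeDeriv φ z.1 z.2 +
      ((Δ (swirl (V z.1))) z.2 - fderiv ℝ (swirl (V z.1)) z.2 (V z.1 z.2) -
        2 / cylRadius z.2 * partialDeriv (eR z.2) (swirl (V z.1)) z.2) * φ z.1 z.2) = 0 := by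
  set Q : Opens (ℝ × (EuclideanSpace ℝ (Fin 3))) := shellCylOpens (1 / 4) 3 2 2 with hQdef
  have hQm : MeasurableSet (Q : Set (ℝ × (EuclideanSpace ℝ (Fin 3)))) := Q.isOpen.measurableSet
  have hNS := hV.suitable.distributional
  -- the test field `ψ = φ J`, its derivatives, and the weak form
  set ψ : ℝ → (EuclideanSpace ℝ (Fin 3)) → (EuclideanSpace ℝ (Fin 3)) := fun s y => φ s y • rotGen y with hψdef
  have hψ : IsSpaceTimeTestOn Q ψ := isSpaceTimeTestOn_smul_rotGen hφ
  have hφ' : ∀ j, IsSpaceTimeTestOn Q (fun t x => fderiv ℝ (φ t) x ((EuclideanSpace.basisFun (Fin 3) ℝ) j)) := fun j =>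
    isSpaceTimeTestOn_fderiv_apply hφ ((EuclideanSpace.basisFun (Fin 3) ℝ) j)
  have hφ'' : ∀ j, IsSpaceTimeTestOn Q
      (fun t x => fderiv ℝ (fun y => fderiv ℝ (φ t) y ((EuclideanSpace.basisFun (Fin 3) ℝ) j)) x ((EuclideanSpace.basisFun (Fin 3) ℝ) j)) := fun j =>
    isSpaceTimeTestOn_fderiv_apply (hφ' j) ((EuclideanSpace.basisFun (Fin 3) ℝ) j)
  -- space–time functions
  set α : ℝ × (EuclideanSpace ℝ (Fin 3)) → ℝ := fun z => swirl (V z.1) z.2 with hα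
  set Pt : ℝ × (EuclideanSpace ℝ (Fin 3)) → ℝ := fun z => P z.1 z.2 * ⟪rotGen z.2, gradient (φ z.1) z.2⟫ with hPt
  set R : ℝ × (EuclideanSpace ℝ (Fin 3)) → ℝ := fun z => α z * timeDeriv φ z.1 z.2 +
    ∑ j, ((α z * ⟪V z.1 z.2, (EuclideanSpace.basisFun (Fin 3) ℝ) j⟫) * fderiv ℝ (φ z.1) z.2 ((EuclideanSpace.basisFun (Fin 3) ℝ) j) -
      2 * (⟪rotGen (V z.1 z.2), (EuclideanSpace.basisFun (Fin 3) ℝ) j⟫ * fderiv ℝ (φ z.1) z.2 ((EuclideanSpace.basisFun (Fin 3) ℝ) j)) +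
      α z * fderiv ℝ (fun y => fderiv ℝ (φ z.1) y ((EuclideanSpace.basisFun (Fin 3) ℝ) j)) z.2 ((EuclideanSpace.basisFun (Fin 3) ℝ) j)) with hR
  set W : Fin 3 → ℝ × (EuclideanSpace ℝ (Fin 3)) → ℝ := fun j z =>
    -fderiv ℝ (fun y => swirl (V z.1) y * ⟪V z.1 y, (EuclideanSpace.basisFun (Fin 3) ℝ) j⟫) z.2 ((EuclideanSpace.basisFun (Fin 3) ℝ) j) +
      2 * ⟪rotGen (fderiv ℝ (V z.1) z.2 ((EuclideanSpace.basisFun (Fin 3) ℝ) j)), (EuclideanSpace.basisFun (Fin 3) ℝ) j⟫ +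
      fderiv ℝ (fun y => fderiv ℝ (swirl (V z.1)) y ((EuclideanSpace.basisFun (Fin 3) ℝ) j)) z.2 ((EuclideanSpace.basisFun (Fin 3) ℝ) j) with hW
  -- (1) the weak form: `∫_Q (R + Pt) = 0`
  have h1 : ∫ z in (Q : Set (ℝ × (EuclideanSpace ℝ (Fin 3)))), (R z + Pt z) = 0 := by
    rw [← hNS.2.2.2.2 ψ hψ]
    refine setIntegral_congr_fun hQm fun z _ => ?_
    exact (nsIntegrand_smul_rotGen_eq_sum (V := V) (P := P) hφ z).symm
  -- (2) the pressure term vanishes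
  have hP0 : ∫ z in (Q : Set (ℝ × (EuclideanSpace ℝ (Fin 3)))), Pt z = 0 :=
    setIntegral_pressure_mul_inner_rotGen_gradient_eq_zero stRot_mem_shellCylOpens hNS
      hV.axisymmetric hφ
  have hPi : IntegrableOn Pt (Q : Set (ℝ × (EuclideanSpace ℝ (Fin 3)))) volume := by
    refine (integrableOn_pressure_mul_divergence hNS hψ).congr_fun (fun z _ => ?_) hQm
    have hφd : DifferentiableAt ℝ (φ z.1) z.2 :=
      ((hφ.contDiff_slice z.1).differentiable (by simp)).differentiableAt
    simp only [hPt, hψdef, divergence_smul_rotGen hφd]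
  -- continuity on `Q` of the velocity factors and integrability of the pieces of `R`
  have hαc : ContinuousOn α (Q : Set (ℝ × (EuclideanSpace ℝ (Fin 3)))) := hV.continuousOn_swirl
  have hVc : ∀ j, ContinuousOn (fun z : ℝ × (EuclideanSpace ℝ (Fin 3)) => α z * ⟪V z.1 z.2, (EuclideanSpace.basisFun (Fin 3) ℝ) j⟫) (Q : Set (ℝ × (EuclideanSpace ℝ (Fin 3)))) :=
    fun j => hαc.mul (hV.continuousOn_inner_const ((EuclideanSpace.basisFun (Fin 3) ℝ) j))
  have hJc : ∀ j, ContinuousOn (fun z : ℝ × (EuclideanSpace ℝ (Fin 3)) => ⟪rotGen (V z.1 z.2), (EuclideanSpace.basisFun (Fin 3) ℝ) j⟫) (Q : Set (ℝ × (EuclideanSpace ℝ (Fin 3)))) :=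
    fun j => (rotGenL.continuous.comp_continuousOn hV.continuousOn_velocity).inner continuousOn_const
  have hWc : ∀ j, ContinuousOn (W j) (Q : Set (ℝ × (EuclideanSpace ℝ (Fin 3)))) := fun j =>
    ((continuousOn_fderiv_swirl_mul_inner hV ((EuclideanSpace.basisFun (Fin 3) ℝ) j)).neg.add
      (continuousOn_const.mul (continuousOn_inner_rotGen_fderiv hV ((EuclideanSpace.basisFun (Fin 3) ℝ) j)))).add
      (hV.continuousOn_fderiv_fderiv_swirl_apply ((EuclideanSpace.basisFun (Fin 3) ℝ) j))
  have iT : Integrable (fun z : ℝ × (EuclideanSpace ℝ (Fin 3)) => α z * timeDeriv φ z.1 z.2) :=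
    integrable_mul_timeDeriv hαc hφ
  have iA : ∀ j, Integrable (fun z : ℝ × (EuclideanSpace ℝ (Fin 3)) =>
      (α z * ⟪V z.1 z.2, (EuclideanSpace.basisFun (Fin 3) ℝ) j⟫) * fderiv ℝ (φ z.1) z.2 ((EuclideanSpace.basisFun (Fin 3) ℝ) j)) :=
    fun j => integrable_mul_test (hVc j) (hφ' j)
  have iB : ∀ j, Integrable (fun z : ℝ × (EuclideanSpace ℝ (Fin 3)) =>
      2 * (⟪rotGen (V z.1 z.2), (EuclideanSpace.basisFun (Fin 3) ℝ) j⟫ * fderiv ℝ (φ z.1) z.2 ((EuclideanSpace.basisFun (Fin 3) ℝ) j))) :=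
    fun j => (integrable_mul_test (hJc j) (hφ' j)).const_mul 2
  have iC : ∀ j, Integrable (fun z : ℝ × (EuclideanSpace ℝ (Fin 3)) =>
      α z * fderiv ℝ (fun y => fderiv ℝ (φ z.1) y ((EuclideanSpace.basisFun (Fin 3) ℝ) j)) z.2 ((EuclideanSpace.basisFun (Fin 3) ℝ) j)) :=
    fun j => integrable_mul_test hαc (hφ'' j)
  have iAB : ∀ j, Integrable (fun z : ℝ × (EuclideanSpace ℝ (Fin 3)) => (α z * ⟪V z.1 z.2, (EuclideanSpace.basisFun (Fin 3) ℝ) j⟫) * fderiv ℝ (φ z.1) z.2 ((EuclideanSpace.basisFun (Fin 3) ℝ) j) -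
      2 * (⟪rotGen (V z.1 z.2), (EuclideanSpace.basisFun (Fin 3) ℝ) j⟫ * fderiv ℝ (φ z.1) z.2 ((EuclideanSpace.basisFun (Fin 3) ℝ) j))) :=
    fun j => (iA j).sub (iB j)
  have iS : ∀ j, Integrable (fun z : ℝ × (EuclideanSpace ℝ (Fin 3)) => (α z * ⟪V z.1 z.2, (EuclideanSpace.basisFun (Fin 3) ℝ) j⟫) * fderiv ℝ (φ z.1) z.2 ((EuclideanSpace.basisFun (Fin 3) ℝ) j) -
      2 * (⟪rotGen (V z.1 z.2), (EuclideanSpace.basisFun (Fin 3) ℝ) j⟫ * fderiv ℝ (φ z.1) z.2 ((EuclideanSpace.basisFun (Fin 3) ℝ) j)) +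
      α z * fderiv ℝ (fun y => fderiv ℝ (φ z.1) y ((EuclideanSpace.basisFun (Fin 3) ℝ) j)) z.2 ((EuclideanSpace.basisFun (Fin 3) ℝ) j)) :=
    fun j => (iAB j).add (iC j)
  have iR : Integrable R := iT.add (integrable_finsetSum _ fun j _ => iS j)
  have iW : ∀ j, Integrable (fun z : ℝ × (EuclideanSpace ℝ (Fin 3)) => W j z * φ z.1 z.2) := fun j =>
    integrable_mul_test (hWc j) hφ
  -- (3) `∫ R = 0` over the whole space (`R` vanishes off `Q`)
  have hR0 : ∀ z, z ∉ (Q : Set (ℝ × (EuclideanSpace ℝ (Fin 3)))) → R z = 0 := by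
    intro z hz
    have hzφ : z ∉ tsupport (uncurry φ) := fun h => hz (hφ.tsupport_subset h)
    have hT : timeDeriv φ z.1 z.2 = 0 := timeDeriv_eq_zero_off_tsupport hzφ
    have hD : ∀ j, fderiv ℝ (φ z.1) z.2 ((EuclideanSpace.basisFun (Fin 3) ℝ) j) = 0 := fun j => by
      simp [fderiv_slice_eq_zero_of_notMem hzφ]
    have hDD : ∀ j, fderiv ℝ (fun y => fderiv ℝ (φ z.1) y ((EuclideanSpace.basisFun (Fin 3) ℝ) j)) z.2 ((EuclideanSpace.basisFun (Fin 3) ℝ) j) = 0 := fun j => by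
      have hz' : z ∉ tsupport (uncurry fun t x => fderiv ℝ (φ t) x ((EuclideanSpace.basisFun (Fin 3) ℝ) j)) :=
        fun h => hz ((hφ' j).tsupport_subset h)
      have h0 : fderiv ℝ (fun y => fderiv ℝ (φ z.1) y ((EuclideanSpace.basisFun (Fin 3) ℝ) j)) z.2 = 0 :=
        fderiv_slice_eq_zero_of_notMem hz'
      rw [h0]
      simp
    simp only [hR, hT, hD, hDD, mul_zero, sub_zero, add_zero, Finset.sum_const_zero]
  have h3 : ∫ z, R z = 0 := by
    have hsplit : ∫ z in (Q : Set (ℝ × (EuclideanSpace ℝ (Fin 3)))), (R z + Pt z) =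
        (∫ z in (Q : Set (ℝ × (EuclideanSpace ℝ (Fin 3)))), R z) + ∫ z in (Q : Set (ℝ × (EuclideanSpace ℝ (Fin 3)))), Pt z :=
      integral_add iR.integrableOn hPi
    rw [hsplit, hP0, add_zero] at h1
    rw [← setIntegral_eq_integral_of_forall_compl_eq_zero (s := (Q : Set (ℝ × (EuclideanSpace ℝ (Fin 3)))))
      fun z hz => hR0 z hz]
    exact h1
  -- (4) linearity and integration by parts, summand by summand
  have h4 : ∫ z, R z = (∫ z : ℝ × (EuclideanSpace ℝ (Fin 3)), α z * timeDeriv φ z.1 z.2) +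
      ∑ j, ((∫ z : ℝ × (EuclideanSpace ℝ (Fin 3)), (α z * ⟪V z.1 z.2, (EuclideanSpace.basisFun (Fin 3) ℝ) j⟫) * fderiv ℝ (φ z.1) z.2 ((EuclideanSpace.basisFun (Fin 3) ℝ) j)) -
        2 * (∫ z : ℝ × (EuclideanSpace ℝ (Fin 3)), ⟪rotGen (V z.1 z.2), (EuclideanSpace.basisFun (Fin 3) ℝ) j⟫ * fderiv ℝ (φ z.1) z.2 ((EuclideanSpace.basisFun (Fin 3) ℝ) j)) +
        ∫ z : ℝ × (EuclideanSpace ℝ (Fin 3)), α z * fderiv ℝ (fun y => fderiv ℝ (φ z.1) y ((EuclideanSpace.basisFun (Fin 3) ℝ) j)) z.2 ((EuclideanSpace.basisFun (Fin 3) ℝ) j)) := by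
    simp only [hR]
    rw [integral_add iT (integrable_finsetSum _ fun j _ => iS j),
      integral_finsetSum _ fun j _ => iS j]
    congr 1
    refine Finset.sum_congr rfl fun j _ => ?_
    rw [integral_add (iAB j) (iC j), integral_sub (iA j) (iB j), integral_const_mul]
  have hIBP : ∀ j, ((∫ z : ℝ × (EuclideanSpace ℝ (Fin 3)), (α z * ⟪V z.1 z.2, (EuclideanSpace.basisFun (Fin 3) ℝ) j⟫) * fderiv ℝ (φ z.1) z.2 ((EuclideanSpace.basisFun (Fin 3) ℝ) j)) -
        2 * (∫ z : ℝ × (EuclideanSpace ℝ (Fin 3)), ⟪rotGen (V z.1 z.2), (EuclideanSpace.basisFun (Fin 3) ℝ) j⟫ * fderiv ℝ (φ z.1) z.2 ((EuclideanSpace.basisFun (Fin 3) ℝ) j)) +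
        ∫ z : ℝ × (EuclideanSpace ℝ (Fin 3)), α z * fderiv ℝ (fun y => fderiv ℝ (φ z.1) y ((EuclideanSpace.basisFun (Fin 3) ℝ) j)) z.2 ((EuclideanSpace.basisFun (Fin 3) ℝ) j)) =
      ∫ z : ℝ × (EuclideanSpace ℝ (Fin 3)), W j z * φ z.1 z.2 := by
    intro j
    have i1 := integrable_mul_test (continuousOn_fderiv_swirl_mul_inner hV ((EuclideanSpace.basisFun (Fin 3) ℝ) j)) hφ
    have i2 := integrable_mul_test (continuousOn_inner_rotGen_fderiv hV ((EuclideanSpace.basisFun (Fin 3) ℝ) j)) hφ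
    have i3 := integrable_mul_test (hV.continuousOn_fderiv_fderiv_swirl_apply ((EuclideanSpace.basisFun (Fin 3) ℝ) j)) hφ
    have e : (fun z : ℝ × (EuclideanSpace ℝ (Fin 3)) => W j z * φ z.1 z.2) = fun z =>
        (-(fderiv ℝ (fun y => swirl (V z.1) y * ⟪V z.1 y, (EuclideanSpace.basisFun (Fin 3) ℝ) j⟫) z.2 ((EuclideanSpace.basisFun (Fin 3) ℝ) j) * φ z.1 z.2) +
          2 * (⟪rotGen (fderiv ℝ (V z.1) z.2 ((EuclideanSpace.basisFun (Fin 3) ℝ) j)), (EuclideanSpace.basisFun (Fin 3) ℝ) j⟫ * φ z.1 z.2)) +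
          fderiv ℝ (fun y => fderiv ℝ (swirl (V z.1)) y ((EuclideanSpace.basisFun (Fin 3) ℝ) j)) z.2 ((EuclideanSpace.basisFun (Fin 3) ℝ) j) * φ z.1 z.2 := by
      funext z
      simp only [hW]
      ring
    have i1n : Integrable (fun z : ℝ × (EuclideanSpace ℝ (Fin 3)) =>
        -(fderiv ℝ (fun y => swirl (V z.1) y * ⟪V z.1 y, (EuclideanSpace.basisFun (Fin 3) ℝ) j⟫) z.2 ((EuclideanSpace.basisFun (Fin 3) ℝ) j) * φ z.1 z.2)) := i1.neg
    have i2c : Integrable (fun z : ℝ × (EuclideanSpace ℝ (Fin 3)) =>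
        2 * (⟪rotGen (fderiv ℝ (V z.1) z.2 ((EuclideanSpace.basisFun (Fin 3) ℝ) j)), (EuclideanSpace.basisFun (Fin 3) ℝ) j⟫ * φ z.1 z.2)) := i2.const_mul 2
    have i12 : Integrable (fun z : ℝ × (EuclideanSpace ℝ (Fin 3)) =>
        (-(fderiv ℝ (fun y => swirl (V z.1) y * ⟪V z.1 y, (EuclideanSpace.basisFun (Fin 3) ℝ) j⟫) z.2 ((EuclideanSpace.basisFun (Fin 3) ℝ) j) * φ z.1 z.2) +
          2 * (⟪rotGen (fderiv ℝ (V z.1) z.2 ((EuclideanSpace.basisFun (Fin 3) ℝ) j)), (EuclideanSpace.basisFun (Fin 3) ℝ) j⟫ * φ z.1 z.2))) := i1n.add i2c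
    rw [e, integral_add i12 i3, integral_add i1n i2c, integral_neg, integral_const_mul]
    simp only [hα]
    rw [integral_swirl_mul_inner_mul_fderiv hV hφ ((EuclideanSpace.basisFun (Fin 3) ℝ) j), integral_inner_rotGen_mul_fderiv hV hφ ((EuclideanSpace.basisFun (Fin 3) ℝ) j),
      integral_swirl_mul_fderiv_fderiv hV hφ ((EuclideanSpace.basisFun (Fin 3) ℝ) j)]
    ring
  -- (5) the pointwise identity on `Q` and the conclusion
  have h5 : ∫ z, R z = ∫ z : ℝ × (EuclideanSpace ℝ (Fin 3)), (α z * timeDeriv φ z.1 z.2 + (∑ j, W j z) * φ z.1 z.2) := by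
    rw [h4]
    simp only [hIBP]
    rw [← integral_finsetSum _ fun j _ => iW j,
      ← integral_add iT (integrable_finsetSum _ fun j _ => iW j)]
    refine integral_congr_ae (Eventually.of_forall fun z => ?_)
    simp only [Finset.sum_mul]
  have h6 : ∫ z : ℝ × (EuclideanSpace ℝ (Fin 3)), (α z * timeDeriv φ z.1 z.2 + (∑ j, W j z) * φ z.1 z.2) =
      ∫ z : ℝ × (EuclideanSpace ℝ (Fin 3)), (swirl (V z.1) z.2 * timeDeriv φ z.1 z.2 +
        ((Δ (swirl (V z.1))) z.2 - fderiv ℝ (swirl (V z.1)) z.2 (V z.1 z.2) -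
          2 / cylRadius z.2 * partialDeriv (eR z.2) (swirl (V z.1)) z.2) * φ z.1 z.2) := by
    refine integral_congr_ae (Eventually.of_forall fun z => ?_)
    by_cases hz : z ∈ (Q : Set (ℝ × (EuclideanSpace ℝ (Fin 3))))
    · have key : ∑ j, W j z = (Δ (swirl (V z.1))) z.2 - fderiv ℝ (swirl (V z.1)) z.2 (V z.1 z.2) -
          2 / cylRadius z.2 * partialDeriv (eR z.2) (swirl (V z.1)) z.2 := by
        simp only [hW]
        exact sum_transfer_eq_swirlOperator hV hz
      simp only [hα, key]
    · simp only [hφ.apply_eq_zero hz, mul_zero, add_zero, hα]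
  rw [← h6, ← h5, h3]

end Weak

end SereginZajaczkowski2007

end Literature.Analysis.FluidPDE
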